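import Literature.MathematicalPhysics.QuantumFieldTheory.Federbush1986.PureAverages

/-!
# `Federbush1986.PureAveragesInvariance` — P. Federbush, *A phase cell approach to Yang–Mills theory. III. Local stability,
# modified renormalization group transformation*, Commun. Math. Phys. **110** (1987) 293–309 [Federbush1987PhaseCellIII], §1
# (1.1)–(1.2), (1.6): the covariance properties of the pure average «by invariance» — the properties (0.5)–(0.7) that Bałaban,
# CMP **109** (1987) p. 253 [Balaban1987RG1], lists for a group average («This definition has all the properties listed above, as
# it was proved by Federbush in [35 (II)]»), PROVED for Federbush's minimiser definition in the abstract bi-invariant setting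

statement-level skeleton of published theorems with citation tags; proofs where landed; nothing here is a claim about the Yang–Mills mass gap

PDF held: `fed1987-cmp110-III` (scan `run/shared/lean/pub/pub-balaban/t4/b2b-balaban-t4-lit2/pdf/fed1987-cmp110-III.pdf`, render
`run/shared/lean/pub/lit-balaban/lit-balaban-r17/renders/fedIII/fed1987-cmp110-III-p003-x2.png` (p. 295); journal page = PDF page
+ 292); [Balaban1987RG1] p. 253 render `run/shared/lean/pub/pub-balaban/b2b-balaban-ref1/pages/…` (B12, PDF 5).

CITATION HEADER (lean-in-tree rule).  lit-balaban cell (HOME `run/shared/lean/pub/lit-balaban/`), SKELETON rows **F3.Eq1.1-1.2**,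
**F3.Eq1.6** (reader r17, `…Federbush1986.PureAverages`: `sumSqDist`, `IsPureAverage`, `isPureAverage_iff_conj`, p238910 —
untouched and imported) and the boundary edge `B12.Eq0.10 → F3.Lem1.3` (B12 (0.5) `M({U_j⁻¹}) = M({U_j})⁻¹`, (0.6)
`M({uU_jv}) = uM({U_j})v`, (0.7) `M(π{U_j}) = M({U_j})`); Phase-2 seat p32 (gen 3), unit `lit-balaban-p32-g3`.
WHAT IS HERE: for ANY group with a bi-invariant distance (`[Group G] [MetricSpace G] [IsIsometricSMul G G]
[IsIsometricSMul Gᵐᵒᵖ G]`, the typing of «an invariant distance constructed from an invariant metric on G», p. 294) and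
Federbush's average = ANY minimiser `ḡ` of (1.2) `Σ_i d²(ḡ, g_i)` (`IsPureAverage`): (0.5) `ḡ` is a pure average of `{g_i}` iff
`ḡ⁻¹` is one of `{g_i⁻¹}` (`isPureAverage_inv_iff`, inversion is an isometry); (0.6) two-sided covariance
(`isPureAverage_mul_right_iff`, `isPureAverage_conj_iff`; the left half is r17's `isPureAverage_iff_conj`); (0.7) invariance under
permutations of the family (`isPureAverage_comp_equiv_iff`).  ((0.8) is Lemma 1.2 and (0.10) is Lemma 1.3, proved for `G = SU(2)` in
`…PureAveragesSU2Lemma12/13`; (0.9) is built into the typing.)  Nothing else is asserted.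
-/

namespace Literature.MathematicalPhysics.QuantumFieldTheory.Federbush1986

open scoped BigOperators

section Permutation

variable {G : Type*} [MetricSpace G]

/-- (1.2) under a PERMUTATION of the family: `Σ_i d²(h, g_{π i}) = Σ_i d²(h, g_i)`. [cite: Federbush1987PhaseCellIII, (1.2) p. 295] -/
theorem sumSqDist_comp_equiv {n : ℕ} (gs : Fin n → G) (σ : Equiv.Perm (Fin n)) (h : G) :
    sumSqDist (gs ∘ σ) h = sumSqDist gs h := by
  simp only [sumSqDist, Function.comp_apply]
  exact Equiv.sum_comp σ (fun i => dist h (gs i) ^ 2)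

/-- **B12 (0.7)** for Federbush's average: the pure averages of `{g_{π i}}` and of `{g_i}` coincide for every permutation `π`
(«M(π{U_j}) = M({U_j})», [Balaban1987RG1] (0.7)). [cite: Federbush1987PhaseCellIII, (1.1)–(1.2) p. 295] -/
theorem isPureAverage_comp_equiv_iff {n : ℕ} (gs : Fin n → G) (σ : Equiv.Perm (Fin n)) (gbar : G) :
    IsPureAverage (gs ∘ σ) gbar ↔ IsPureAverage gs gbar := by
  simp only [IsPureAverage, sumSqDist_comp_equiv]

end Permutation

section RightInvariance

variable {G : Type*} [Group G] [MetricSpace G] [IsIsometricSMul Gᵐᵒᵖ G]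

/-- (1.2) is invariant under RIGHT translation: `Σ d²(hv, g_iv) = Σ d²(h, g_i)` («by invariance», (1.6)).
[cite: Federbush1987PhaseCellIII, (1.2), (1.6) p. 295] -/
theorem sumSqDist_mul_right {n : ℕ} (gs : Fin n → G) (h v : G) :
    sumSqDist (fun i => gs i * v) (h * v) = sumSqDist gs h := by
  simp [sumSqDist, dist_mul_right]

/-- **B12 (0.6), right half** for Federbush's average: `ḡ` is a pure average of `{g_i}` iff `ḡv` is a pure average of `{g_iv}`
(«M({uU_jv}) = uM({U_j})v», [Balaban1987RG1] (0.6); «by invariance», (1.6)).  [cite: Federbush1987PhaseCellIII, (1.2), (1.6) p. 295] -/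
theorem isPureAverage_mul_right_iff {n : ℕ} (gs : Fin n → G) (gbar v : G) :
    IsPureAverage (fun i => gs i * v) (gbar * v) ↔ IsPureAverage gs gbar := by
  constructor
  · intro H h
    have := H (h * v)
    rwa [sumSqDist_mul_right, sumSqDist_mul_right] at this
  · intro H h
    have := H (h * v⁻¹)
    rw [← sumSqDist_mul_right gs gbar v, ← sumSqDist_mul_right gs (h * v⁻¹) v, inv_mul_cancel_right] at this
    exact this

end RightInvariance

section BiInvariance

variable {G : Type*} [Group G] [MetricSpace G] [IsIsometricSMul G G] [IsIsometricSMul Gᵐᵒᵖ G]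

/-- **B12 (0.6)** for Federbush's average, two-sided: `ḡ` is a pure average of `{g_i}` iff `uḡv` is a pure average of `{ug_iv}`.
[cite: Federbush1987PhaseCellIII, (1.2), (1.6) p. 295] -/
theorem isPureAverage_conj_iff {n : ℕ} (gs : Fin n → G) (gbar u v : G) :
    IsPureAverage (fun i => u * gs i * v) (u * gbar * v) ↔ IsPureAverage gs gbar := by
  rw [isPureAverage_mul_right_iff (fun i => u * gs i) (u * gbar) v, ← isPureAverage_iff_conj gs gbar u]

/-- (1.2) under INVERSION: `Σ d²(h, g_i⁻¹) = Σ d²(h⁻¹, g_i)` (inversion is an isometry of a bi-invariant distance).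
[cite: Federbush1987PhaseCellIII, (1.2), (1.6) p. 295] -/
theorem sumSqDist_inv {n : ℕ} (gs : Fin n → G) (h : G) :
    sumSqDist (fun i => (gs i)⁻¹) h = sumSqDist gs h⁻¹ := by
  simp only [sumSqDist]
  refine Finset.sum_congr rfl fun i _ => ?_
  rw [← dist_inv_inv h (gs i)⁻¹, inv_inv]

/-- **B12 (0.5)** for Federbush's average: `ḡ⁻¹` is a pure average of `{g_i⁻¹}` iff `ḡ` is a pure average of `{g_i}`
(«M({U_j⁻¹}) = M({U_j})⁻¹», [Balaban1987RG1] (0.5)). [cite: Federbush1987PhaseCellIII, (1.2), (1.6) p. 295] -/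
theorem isPureAverage_inv_iff {n : ℕ} (gs : Fin n → G) (gbar : G) :
    IsPureAverage (fun i => (gs i)⁻¹) gbar⁻¹ ↔ IsPureAverage gs gbar := by
  constructor
  · intro H h
    have := H h⁻¹
    rwa [sumSqDist_inv, sumSqDist_inv, inv_inv, inv_inv] at this
  · intro H h
    have := H h⁻¹
    rwa [sumSqDist_inv, sumSqDist_inv, inv_inv]

end BiInvariance

end Literature.MathematicalPhysics.QuantumFieldTheory.Federbush1986
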